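import Mathlib
import Literature.NumberTheory.Irrationality.BrownZudilin2022.GeneralFamily
import Literature.NumberTheory.Irrationality.BrownZudilin2022.CubicalForm
import Literature.NumberTheory.Irrationality.BrownZudilin2022.BarnesRepresentation
import Summits.KontsevichZagierPeriods.Zeta5Search.WedgeDictionaryKernel

/-!
# ATLAS helpers: a common rational chamber point from integer bounds (cell `pub-zeta5`, lineage gen-1, g21)

HONEST FRAMING: systematic search; no irrationality claim unless certified.  Structure of gen-1's period dictionary
(`WedgeDictionary.explicitPQ`, an OPEN conjecture node) only; nothing about linear forms or ζ(5); nothing is evaluated.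

OUR work (Summit side).  `chamber_point`: from integer letter bounds `0 < U_m, 0 < V_n, 0 ≤ L < R, L < U_m + V_n` a rational point
`(c₁, c₂)` with `0 < c₁ < U_m`, `0 < c₂ < V_n`, `L < c₁ + c₂ < R` (explicitly `c = s·(B₁, B₂)`, `B` the minima, `s = (L + 1/2)/(B₁ + B₂)`);
`chamberQ_of_bounds`: such a point lies in `ChamberQ p q` of every member whose letters dominate the bounds.  Used by the dispatcher
files `WedgeDictionaryKernelAtlasPencil<i>.lean` (memo D2-CELLULAR-g21.md §6–§7).  Generator `code/gen1/g21/atlasgen.py`.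
-/

set_option maxHeartbeats 8000000
set_option linter.unusedSimpArgs false
set_option linter.unusedTactic false
set_option linter.unreachableTactic false
set_option linter.unnecessarySeqFocus false
set_option linter.style.longLine false
set_option linter.unusedVariables false
namespace Summit.KontsevichZagierPeriods.Zeta5Search.WedgeDictionary.KernelCells

open Literature.NumberTheory.Irrationality.BrownZudilin2022 MeasureTheory
open Summit.KontsevichZagierPeriods.Zeta5Search.WedgeDictionary.Kernel

/-- Core of `chamber_point`: a rational point below `(B₁, B₂)` coordinatewise with `L < c₁ + c₂ < R`. -/
theorem chamber_point_core (B1 B2 L R : ℤ) (hB1 : 0 < B1) (hB2 : 0 < B2) (hL : 0 ≤ L) (hLB : L < B1 + B2) (hLR : L < R) :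
    ∃ c₁ c₂ : ℚ, 0 < c₁ ∧ c₁ < B1 ∧ 0 < c₂ ∧ c₂ < B2 ∧ (L : ℚ) < c₁ + c₂ ∧ c₁ + c₂ < R := by
  have hS : (0 : ℚ) < (B1 : ℚ) + B2 := by exact_mod_cast (show (0 : ℤ) < B1 + B2 by omega)
  have hSne : (B1 : ℚ) + B2 ≠ 0 := ne_of_gt hS
  have hB1' : (0 : ℚ) < B1 := by exact_mod_cast hB1
  have hB2' : (0 : ℚ) < B2 := by exact_mod_cast hB2
  have hL' : (0 : ℚ) ≤ L := by exact_mod_cast hL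
  have hLB' : (L : ℚ) + 1 ≤ (B1 : ℚ) + B2 := by exact_mod_cast (show L + 1 ≤ B1 + B2 by omega)
  have hLR' : (L : ℚ) + 1 ≤ R := by exact_mod_cast (show L + 1 ≤ R by omega)
  have hs0 : 0 < ((L : ℚ) + 1 / 2) / ((B1 : ℚ) + B2) := div_pos (by linarith) hS
  have hs1 : ((L : ℚ) + 1 / 2) / ((B1 : ℚ) + B2) < 1 := by rw [div_lt_one hS]; linarith
  have hsum : ((L : ℚ) + 1 / 2) / ((B1 : ℚ) + B2) * B1 + ((L : ℚ) + 1 / 2) / ((B1 : ℚ) + B2) * B2 = (L : ℚ) + 1 / 2 := by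
    field_simp
  refine ⟨((L : ℚ) + 1 / 2) / ((B1 : ℚ) + B2) * B1, ((L : ℚ) + 1 / 2) / ((B1 : ℚ) + B2) * B2, mul_pos hs0 hB1', ?_,
    mul_pos hs0 hB2', ?_, ?_, ?_⟩
  · nlinarith
  · nlinarith
  · rw [hsum]; linarith
  · rw [hsum]; linarith

/-- A common rational point from integer bounds: `0 < c₁ < U_m (m = 0,1,2)`, `0 < c₂ < V_n`, `L < c₁ + c₂ < R`, provided all bounds are
positive, `0 ≤ L < R` and `L < U_m + V_n` for all `m, n`. -/
theorem chamber_point (U0 U1 U2 V0 V1 V2 L R : ℤ) (hU0 : 0 < U0) (hU1 : 0 < U1) (hU2 : 0 < U2) (hV0 : 0 < V0) (hV1 : 0 < V1)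
    (hV2 : 0 < V2) (hL : 0 ≤ L) (hLR : L < R) (h00 : L < U0 + V0) (h01 : L < U0 + V1) (h02 : L < U0 + V2) (h10 : L < U1 + V0)
    (h11 : L < U1 + V1) (h12 : L < U1 + V2) (h20 : L < U2 + V0) (h21 : L < U2 + V1) (h22 : L < U2 + V2) :
    ∃ c₁ c₂ : ℚ, (0 < c₁ ∧ c₁ < U0 ∧ c₁ < U1 ∧ c₁ < U2 ∧ 0 < c₂ ∧ c₂ < V0 ∧ c₂ < V1 ∧ c₂ < V2 ∧ (L : ℚ) < c₁ + c₂ ∧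
      c₁ + c₂ < R) := by
  have eB1 : ∃ B1 : ℤ, B1 ≤ U0 ∧ B1 ≤ U1 ∧ B1 ≤ U2 ∧ 0 < B1 ∧ L < B1 + V0 ∧ L < B1 + V1 ∧ L < B1 + V2 := by
    rcases le_total U0 U1 with g1 | g1 <;> rcases le_total U0 U2 with g2 | g2 <;> rcases le_total U1 U2 with g3 | g3
    all_goals first
      | exact ⟨U0, le_refl _, by omega, by omega, hU0, h00, h01, h02⟩
      | exact ⟨U1, by omega, le_refl _, by omega, hU1, h10, h11, h12⟩
      | exact ⟨U2, by omega, by omega, le_refl _, hU2, h20, h21, h22⟩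
  obtain ⟨B1, hB1U0, hB1U1, hB1U2, hB1, g0, g1, g2⟩ := eB1
  have eB2 : ∃ B2 : ℤ, B2 ≤ V0 ∧ B2 ≤ V1 ∧ B2 ≤ V2 ∧ 0 < B2 ∧ L < B1 + B2 := by
    rcases le_total V0 V1 with g1' | g1' <;> rcases le_total V0 V2 with g2' | g2' <;> rcases le_total V1 V2 with g3' | g3'
    all_goals first
      | exact ⟨V0, le_refl _, by omega, by omega, hV0, g0⟩
      | exact ⟨V1, by omega, le_refl _, by omega, hV1, g1⟩
      | exact ⟨V2, by omega, by omega, le_refl _, hV2, g2⟩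
  obtain ⟨B2, hB2V0, hB2V1, hB2V2, hB2, hLB⟩ := eB2
  obtain ⟨c₁, c₂, k1, k2, k3, k4, k5, k6⟩ := chamber_point_core B1 B2 L R hB1 hB2 hL hLB hLR
  have e0 : (B1 : ℚ) ≤ U0 := by exact_mod_cast hB1U0
  have e1 : (B1 : ℚ) ≤ U1 := by exact_mod_cast hB1U1
  have e2 : (B1 : ℚ) ≤ U2 := by exact_mod_cast hB1U2
  have e4 : (B2 : ℚ) ≤ V0 := by exact_mod_cast hB2V0
  have e5 : (B2 : ℚ) ≤ V1 := by exact_mod_cast hB2V1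
  have e6 : (B2 : ℚ) ≤ V2 := by exact_mod_cast hB2V2
  exact ⟨c₁, c₂, k1, lt_of_lt_of_le k2 e0, lt_of_lt_of_le k2 e1, lt_of_lt_of_le k2 e2, k3, lt_of_lt_of_le k4 e4,
    lt_of_lt_of_le k4 e5, lt_of_lt_of_le k4 e6, k5, k6⟩

/-- A point within integer bounds dominated by a member's letters lies in that member's `ChamberQ`. -/
theorem chamberQ_of_bounds {p : Fin 7 → ℤ} {q : Fin 5 → ℤ} {c₁ c₂ : ℚ} (U0 U1 U2 V0 V1 V2 L R : ℤ)
    (hc : 0 < c₁ ∧ c₁ < U0 ∧ c₁ < U1 ∧ c₁ < U2 ∧ 0 < c₂ ∧ c₂ < V0 ∧ c₂ < V1 ∧ c₂ < V2 ∧ (L : ℚ) < c₁ + c₂ ∧ c₁ + c₂ < R)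
    (h0 : U0 ≤ 1 + p 0) (h1 : U1 ≤ 1 + p 1) (h2 : U2 ≤ 1 + p 2) (h4 : V0 ≤ 1 + p 4) (h5 : V1 ≤ 1 + p 5) (h6 : V2 ≤ 1 + p 6)
    (hL : 1 + p 0 + p 6 - q 2 ≤ L) (hR : R ≤ p 3 + 2) : ChamberQ p q c₁ c₂ := by
  obtain ⟨k1, k2, k3, k4, k5, k6, k7, k8, k9, k10⟩ := hc
  have e0 : (U0 : ℚ) ≤ 1 + (p 0 : ℚ) := by exact_mod_cast h0
  have e1 : (U1 : ℚ) ≤ 1 + (p 1 : ℚ) := by exact_mod_cast h1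
  have e2 : (U2 : ℚ) ≤ 1 + (p 2 : ℚ) := by exact_mod_cast h2
  have e4 : (V0 : ℚ) ≤ 1 + (p 4 : ℚ) := by exact_mod_cast h4
  have e5 : (V1 : ℚ) ≤ 1 + (p 5 : ℚ) := by exact_mod_cast h5
  have e6 : (V2 : ℚ) ≤ 1 + (p 6 : ℚ) := by exact_mod_cast h6
  have eL : (1 : ℚ) + p 0 + p 6 - q 2 ≤ (L : ℚ) := by exact_mod_cast hL
  have eR : (R : ℚ) ≤ (p 3 : ℚ) + 2 := by exact_mod_cast hR
  refine ⟨k1, ?_, k5, ?_, by linarith, by linarith⟩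
  · rw [← min_add_add_left, ← min_add_add_left]
    exact lt_min (by linarith) (lt_min (by linarith) (by linarith))
  · rw [← min_add_add_left, ← min_add_add_left]
    exact lt_min (by linarith) (lt_min (by linarith) (by linarith))

end Summit.KontsevichZagierPeriods.Zeta5Search.WedgeDictionary.KernelCells
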